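import Literature.Barriers.CriticalPhenomena.WeaklySAWSuperGaussian
import Literature.MathematicalPhysics.QuantumLattice.GrassmannCoefficientMap
import Literature.MathematicalPhysics.QuantumLattice.GrassmannGaussianAddition
import HarnessLib

/-!
# BBS 2015, §4.1, eq. (4.21): the doubled algebra `𝒩^×` and the homomorphism `θ`,
# `θF(φ,ξ,ψ,η) = F(φ+ξ, ψ+η)`

Bauerschmidt–Brydges–Slade, CMP 337 (2015), arXiv:1403.7422, §4.1: "We also define an algebra `𝒩^×`
with twice as many fields as `𝒩`, namely with boson fields `(φ,ξ)` and fermion fields `(ψ,η)` …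
Given a form `F = f(φ,φ̄)ψ^xψ̄^y` we define `θF = f(φ+ξ, φ̄+ξ̄)(ψ+η)^x(ψ̄+η̄)^y` ((4.21)) and extend
this to a map `θ : 𝒩 → 𝒩^×` by linearity." This file builds `𝒩^×` and `θ` on top of the form algebra
`SForm Λ` of `WeaklySAWSuperGaussian.lean`, as a composition of the tree's substitution tools:

* `FieldFun2 Λ` (`0`-forms in `(φ, ξ)`), **`SForm2 Λ = 𝒩^×`** = the Grassmann algebra over `FieldFun2 Λ`
  on the generators `(Λ ⊔ Λ) ⊔ (Λ ⊔ Λ)` — the block `blockPsi` of `ψ̄, ψ` followed by the block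
  `blockEta` of `η̄, η` (the order embeddings `inlLex`, `inrLex` of `GrassmannGaussianAddition.lean`);
  `ofFun2`, `psiOne`, `psiBarOne`, `eta`, `etaBar`;
* the coefficient maps `extCoeff` (`f(φ) ↦ f(φ)`), `fluctCoeff` (`f ↦ f(ξ)`), `shiftCoeff`
  (`f ↦ f(φ+ξ)`), ring homomorphisms `FieldFun Λ →+* FieldFun2 Λ`;
* **`embedPsi`, `embedEta : SForm Λ →+* SForm2 Λ`** — a form read as a form in `(φ,ψ)`, resp. in the
  fluctuation fields `(ξ,η)` (`GrassmannAlgebra.coeffMap` followed by the generator embedding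
  `ExteriorAlgebra.map (extendByZero block)`), with their values on `ofFun`, `ψ_x`, `ψ̄_x`;
* **`thetaForm : SForm Λ →+* SForm2 Λ` = `θ`** ((4.21)): `coeffMap shiftCoeff` (`f ↦ f(φ+ξ)`), then the
  embedding into the `ψ`-block, then the substitution `ψ ↦ ψ + η` (`ExteriorAlgebra.map (1 + fieldShift)`,
  the map `Δ` of the tree's addition principle `berezinOn_gaussian_fieldSum`); **`thetaForm_ofFun`**
  (`θf = f(φ+ξ)`), **`thetaForm_psi`** (`θψ_x = ψ_x + η_x`), **`thetaForm_psiBar`**, `thetaForm_tau`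
  (`θτ_x = (φ_x+ξ_x)(φ̄_x+ξ̄_x) + (ψ_x+η_x)(ψ̄_x+η̄_x)`), and multiplicativity (a ring homomorphism by
  construction: "`θ(FG) = (θF)(θG)`").

Everything is proved; no named facts. The Gaussian super-expectation in the fluctuation fields,
`E_C θ : 𝒩 → 𝒩` ((4.22)–(4.24)), is not in this file.
-/

noncomputable section

open Complex ComplexConjugate
open Literature.MathematicalPhysics.QuantumLattice
open Literature.MathematicalPhysics.QuantumLattice.GrassmannAlgebra (berezin gen coeffMap)
open scoped BigOperators

namespace Literature.Barriers.CriticalPhenomena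

namespace CTWSAW

section Doubling

variable (Λ : Type*)

/-- The `0`-forms of the doubled algebra: functions of the external boson field `φ` and the fluctuation
field `ξ`. [cite: BauerschmidtBrydgesSlade2015LogCorr, §4.1 ("an algebra 𝒩^× with twice as many fields as 𝒩, namely with boson fields (φ,ξ)")] -/
abbrev FieldFun2 : Type _ := ((Λ → ℂ) × (Λ → ℂ)) → ℂ

variable {Λ}
variable [LinearOrder Λ]

/-- The generator index set `(Λ ⊔ Λ) ⊔ (Λ ⊔ Λ)` of `𝒩^×`: `ψ̄, ψ` then `η̄, η`. [folklore] -/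
abbrev DGen (Λ : Type*) [LinearOrder Λ] : Type _ := (Λ ⊕ₗ Λ) ⊕ₗ (Λ ⊕ₗ Λ)

/-- **The doubled algebra `𝒩^×`**: forms in the boson fields `(φ,ξ)` and the fermion fields `(ψ,η)`
(`ψ = (2πi)^{-1/2}dφ`, `η = (2πi)^{-1/2}dξ`), with the four conjugate fields.
[cite: BauerschmidtBrydgesSlade2015LogCorr, §4.1 (the algebra 𝒩^× with boson fields (φ,ξ) and fermion fields (ψ,η))] -/
abbrev SForm2 (Λ : Type*) [LinearOrder Λ] : Type _ := GrassmannAlgebra (FieldFun2 Λ) (DGen Λ)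

/-- The block of the `ψ̄, ψ` generators. [folklore] -/
def blockPsi (Λ : Type*) [LinearOrder Λ] : (Λ ⊕ₗ Λ) ↪o DGen Λ := inlLex (Λ ⊕ₗ Λ) (Λ ⊕ₗ Λ)

/-- The block of the `η̄, η` generators. [folklore] -/
def blockEta (Λ : Type*) [LinearOrder Λ] : (Λ ⊕ₗ Λ) ↪o DGen Λ := inrLex (Λ ⊕ₗ Λ) (Λ ⊕ₗ Λ)

/-- A `0`-form of `𝒩^×` as an element of the algebra. [folklore] -/
def ofFun2 (f : FieldFun2 Λ) : SForm2 Λ := algebraMap (FieldFun2 Λ) (SForm2 Λ) f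

/-- `ψ_x` in `𝒩^×`. [folklore] -/
def psiOne (x : Λ) : SForm2 Λ := gen (FieldFun2 Λ) (blockPsi Λ (toLex (Sum.inr x)))

/-- `ψ̄_x` in `𝒩^×`. [folklore] -/
def psiBarOne (x : Λ) : SForm2 Λ := gen (FieldFun2 Λ) (blockPsi Λ (toLex (Sum.inl x)))

/-- `η_x` in `𝒩^×`. [folklore] -/
def eta (x : Λ) : SForm2 Λ := gen (FieldFun2 Λ) (blockEta Λ (toLex (Sum.inr x)))

/-- `η̄_x` in `𝒩^×`. [folklore] -/
def etaBar (x : Λ) : SForm2 Λ := gen (FieldFun2 Λ) (blockEta Λ (toLex (Sum.inl x)))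

/-! #### The three coefficient maps -/

omit [LinearOrder Λ] in
/-- `f ↦ ((φ,ξ) ↦ f(φ))`. [folklore] -/
def extCoeff : FieldFun Λ →+* FieldFun2 Λ where
  toFun f := fun p => f p.1
  map_one' := rfl
  map_mul' _ _ := rfl
  map_zero' := rfl
  map_add' _ _ := rfl

omit [LinearOrder Λ] in
/-- `f ↦ ((φ,ξ) ↦ f(ξ))`. [folklore] -/
def fluctCoeff : FieldFun Λ →+* FieldFun2 Λ where
  toFun f := fun p => f p.2
  map_one' := rfl
  map_mul' _ _ := rfl
  map_zero' := rfl
  map_add' _ _ := rfl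

omit [LinearOrder Λ] in
/-- `f ↦ ((φ,ξ) ↦ f(φ+ξ))` — the bosonic part of `θ`. [cite: BauerschmidtBrydgesSlade2015LogCorr, §4.1, eq. (4.21)] -/
def shiftCoeff : FieldFun Λ →+* FieldFun2 Λ where
  toFun f := fun p => f (p.1 + p.2)
  map_one' := rfl
  map_mul' _ _ := rfl
  map_zero' := rfl
  map_add' _ _ := rfl

omit [LinearOrder Λ] in
/-- Unfolding `extCoeff`. [folklore] -/
@[simp] theorem extCoeff_apply (f : FieldFun Λ) (p : (Λ → ℂ) × (Λ → ℂ)) : extCoeff f p = f p.1 := rfl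

omit [LinearOrder Λ] in
/-- Unfolding `fluctCoeff`. [folklore] -/
@[simp] theorem fluctCoeff_apply (f : FieldFun Λ) (p : (Λ → ℂ) × (Λ → ℂ)) : fluctCoeff f p = f p.2 := rfl

omit [LinearOrder Λ] in
/-- Unfolding `shiftCoeff`. [folklore] -/
@[simp] theorem shiftCoeff_apply (f : FieldFun Λ) (p : (Λ → ℂ) × (Λ → ℂ)) : shiftCoeff f p = f (p.1 + p.2) := rfl

variable [Fintype Λ]

/-! #### Embeddings of `𝒩` into `𝒩^×` and the homomorphism `θ` -/

/-- The generator embedding of the `ψ`-block. [folklore] -/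
def mapPsi : GrassmannAlgebra (FieldFun2 Λ) (Λ ⊕ₗ Λ) →ₐ[FieldFun2 Λ] SForm2 Λ :=
  ExteriorAlgebra.map (Function.ExtendByZero.linearMap (FieldFun2 Λ) (blockPsi Λ))

/-- The generator embedding of the `η`-block. [folklore] -/
def mapEta : GrassmannAlgebra (FieldFun2 Λ) (Λ ⊕ₗ Λ) →ₐ[FieldFun2 Λ] SForm2 Λ :=
  ExteriorAlgebra.map (Function.ExtendByZero.linearMap (FieldFun2 Λ) (blockEta Λ))

/-- The substitution `ψ ↦ ψ + η`, `ψ̄ ↦ ψ̄ + η̄` on `𝒩^×` (the map `Δ` of the addition principle).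
[cite: BauerschmidtBrydgesSlade2015LogCorr, §4.1, eq. (4.21) ((ψ+η)^x(ψ̄+η̄)^y)] -/
def shiftPsi : SForm2 Λ →ₐ[FieldFun2 Λ] SForm2 Λ :=
  ExteriorAlgebra.map (1 + fieldShift (FieldFun2 Λ) (blockPsi Λ) (blockEta Λ))

/-- **`F(φ,ψ)` read as a form of `𝒩^×`** (coefficients `f(φ)`, generators in the `ψ`-block). [folklore] -/
def embedPsi : SForm Λ →+* SForm2 Λ := (mapPsi (Λ := Λ)).toRingHom.comp (coeffMap extCoeff)

/-- **`F(ξ,η)`: a form of `𝒩` in the fluctuation fields** (coefficients `f(ξ)`, generators in the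
`η`-block). [folklore] -/
def embedEta : SForm Λ →+* SForm2 Λ := (mapEta (Λ := Λ)).toRingHom.comp (coeffMap fluctCoeff)

/-- **`θ : 𝒩 → 𝒩^×`, `θF(φ,ξ,ψ,η) = F(φ+ξ, ψ+η)`** ((4.21)): the change of coefficients
`f ↦ f(φ+ξ)`, the embedding into the `ψ`-block, and the substitution `ψ ↦ ψ+η`; a ring homomorphism
(the source: "extend this to a map θ : 𝒩 → 𝒩^× by linearity"; multiplicativity holds as well).
[cite: BauerschmidtBrydgesSlade2015LogCorr, §4.1, eq. (4.21)] -/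
def thetaForm : SForm Λ →+* SForm2 Λ :=
  (shiftPsi (Λ := Λ)).toRingHom.comp ((mapPsi (Λ := Λ)).toRingHom.comp (coeffMap shiftCoeff))

/-- Unfolding `embedPsi`. [folklore] -/
theorem embedPsi_apply (K : SForm Λ) : embedPsi K = mapPsi (coeffMap extCoeff K) := rfl

/-- Unfolding `embedEta`. [folklore] -/
theorem embedEta_apply (K : SForm Λ) : embedEta K = mapEta (coeffMap fluctCoeff K) := rfl

/-- Unfolding `thetaForm`. [folklore] -/
theorem thetaForm_apply (K : SForm Λ) : thetaForm K = shiftPsi (mapPsi (coeffMap shiftCoeff K)) := rfl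

/-- `embedPsi` on `0`-forms: `f(φ) ↦ f(φ)`. [folklore] -/
theorem embedPsi_ofFun (f : FieldFun Λ) : embedPsi (ofFun f) = ofFun2 (fun p => f p.1) := by
  rw [embedPsi_apply, ofFun, GrassmannAlgebra.coeffMap_algebraMap, mapPsi, AlgHom.commutes]; rfl

/-- `embedEta` on `0`-forms: `f ↦ f(ξ)`. [folklore] -/
theorem embedEta_ofFun (f : FieldFun Λ) : embedEta (ofFun f) = ofFun2 (fun p => f p.2) := by
  rw [embedEta_apply, ofFun, GrassmannAlgebra.coeffMap_algebraMap, mapEta, AlgHom.commutes]; rfl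

/-- **`θ` on `0`-forms: `θf = f(φ+ξ)`** ("if `F = f(φ)` is of degree `0`, …"). [cite: BauerschmidtBrydgesSlade2015LogCorr, §4.1, eqs. (4.21)–(4.22)] -/
theorem thetaForm_ofFun (f : FieldFun Λ) : thetaForm (ofFun f) = ofFun2 (fun p => f (p.1 + p.2)) := by
  rw [thetaForm_apply, ofFun, GrassmannAlgebra.coeffMap_algebraMap, mapPsi, AlgHom.commutes, shiftPsi,
    AlgHom.commutes]
  rfl

/-- `coeffMap` fixes `ψ_x` (up to the coefficient ring). [folklore] -/
theorem coeffMap_psi (σ : FieldFun Λ →+* FieldFun2 Λ) (x : Λ) :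
    coeffMap σ (psi (FieldFun Λ) x) = psi (FieldFun2 Λ) x := by
  unfold psi; exact GrassmannAlgebra.coeffMap_gen _ _

/-- `coeffMap` fixes `ψ̄_x`. [folklore] -/
theorem coeffMap_psiBar (σ : FieldFun Λ →+* FieldFun2 Λ) (x : Λ) :
    coeffMap σ (psiBar (FieldFun Λ) x) = psiBar (FieldFun2 Λ) x := by
  unfold psiBar; exact GrassmannAlgebra.coeffMap_gen _ _

/-- The `ψ`-block embedding on `ψ_x`. [folklore] -/
theorem mapPsi_psi (x : Λ) : mapPsi (psi (FieldFun2 Λ) x) = psiOne x := by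
  unfold mapPsi psi psiOne; exact GrassmannAlgebra.map_extendByZero_gen' _ _ _

/-- The `ψ`-block embedding on `ψ̄_x`. [folklore] -/
theorem mapPsi_psiBar (x : Λ) : mapPsi (psiBar (FieldFun2 Λ) x) = psiBarOne x := by
  unfold mapPsi psiBar psiBarOne; exact GrassmannAlgebra.map_extendByZero_gen' _ _ _

/-- The `η`-block embedding on `ψ_x` gives `η_x`. [folklore] -/
theorem mapEta_psi (x : Λ) : mapEta (psi (FieldFun2 Λ) x) = eta x := by
  unfold mapEta psi eta; exact GrassmannAlgebra.map_extendByZero_gen' _ _ _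

/-- The `η`-block embedding on `ψ̄_x` gives `η̄_x`. [folklore] -/
theorem mapEta_psiBar (x : Λ) : mapEta (psiBar (FieldFun2 Λ) x) = etaBar x := by
  unfold mapEta psiBar etaBar; exact GrassmannAlgebra.map_extendByZero_gen' _ _ _

/-- `ψ_x ↦ ψ_x + η_x` under the shift. [folklore] -/
theorem shiftPsi_psiOne (x : Λ) : shiftPsi (psiOne x) = psiOne x + eta x := by
  unfold shiftPsi psiOne eta; exact map_one_add_fieldShift_gen_range _ _ _ _

/-- `ψ̄_x ↦ ψ̄_x + η̄_x` under the shift. [folklore] -/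
theorem shiftPsi_psiBarOne (x : Λ) : shiftPsi (psiBarOne x) = psiBarOne x + etaBar x := by
  unfold shiftPsi psiBarOne etaBar; exact map_one_add_fieldShift_gen_range _ _ _ _

/-- `embedPsi ψ_x = ψ_x`. [folklore] -/
theorem embedPsi_psi (x : Λ) : embedPsi (psi (FieldFun Λ) x) = psiOne x := by
  rw [embedPsi_apply, coeffMap_psi, mapPsi_psi]

/-- `embedPsi ψ̄_x = ψ̄_x`. [folklore] -/
theorem embedPsi_psiBar (x : Λ) : embedPsi (psiBar (FieldFun Λ) x) = psiBarOne x := by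
  rw [embedPsi_apply, coeffMap_psiBar, mapPsi_psiBar]

/-- `embedEta ψ_x = η_x` (the fluctuation fermion). [folklore] -/
theorem embedEta_psi (x : Λ) : embedEta (psi (FieldFun Λ) x) = eta x := by
  rw [embedEta_apply, coeffMap_psi, mapEta_psi]

/-- `embedEta ψ̄_x = η̄_x`. [folklore] -/
theorem embedEta_psiBar (x : Λ) : embedEta (psiBar (FieldFun Λ) x) = etaBar x := by
  rw [embedEta_apply, coeffMap_psiBar, mapEta_psiBar]

/-- **`θψ_x = ψ_x + η_x`**. [cite: BauerschmidtBrydgesSlade2015LogCorr, §4.1, eq. (4.21)] -/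
theorem thetaForm_psi (x : Λ) : thetaForm (psi (FieldFun Λ) x) = psiOne x + eta x := by
  rw [thetaForm_apply, coeffMap_psi, mapPsi_psi, shiftPsi_psiOne]

/-- **`θψ̄_x = ψ̄_x + η̄_x`**. [cite: BauerschmidtBrydgesSlade2015LogCorr, §4.1, eq. (4.21)] -/
theorem thetaForm_psiBar (x : Λ) : thetaForm (psiBar (FieldFun Λ) x) = psiBarOne x + etaBar x := by
  rw [thetaForm_apply, coeffMap_psiBar, mapPsi_psiBar, shiftPsi_psiBarOne]

/-- **`θ(FG) = θF·θG`** and `θ(F+G) = θF + θG`: `θ` is a ring homomorphism. [folklore] -/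
theorem thetaForm_mul (F G : SForm Λ) : thetaForm (F * G) = thetaForm F * thetaForm G := map_mul _ F G

/-- **`θτ_x = (φ_x+ξ_x)(φ̄_x+ξ̄_x) + (ψ_x+η_x)(ψ̄_x+η̄_x)`**. [cite: BauerschmidtBrydgesSlade2015LogCorr, §4.1, eq. (4.21) with §3.3 (τ_x)] -/
theorem thetaForm_tau (x : Λ) :
    thetaForm (tau x) = ofFun2 (fun p => (p.1 x + p.2 x) * conj (p.1 x + p.2 x)) +
      (psiOne x + eta x) * (psiBarOne x + etaBar x) := by
  rw [tau, map_add, map_mul, thetaForm_ofFun, thetaForm_psi, thetaForm_psiBar]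
  rfl

/-- `embedPsi τ_x = φ_xφ̄_x + ψ_xψ̄_x` (the form `τ_x` of the external fields inside `𝒩^×`). [folklore] -/
theorem embedPsi_tau (x : Λ) :
    embedPsi (tau x) = ofFun2 (fun p => p.1 x * conj (p.1 x)) + psiOne x * psiBarOne x := by
  rw [tau, map_add, map_mul, embedPsi_ofFun, embedPsi_psi, embedPsi_psiBar]

/-- `embedEta τ_x = ξ_xξ̄_x + η_xη̄_x` (the form `τ_x` of the fluctuation fields). [folklore] -/
theorem embedEta_tau (x : Λ) :
    embedEta (tau x) = ofFun2 (fun p => p.2 x * conj (p.2 x)) + eta x * etaBar x := by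
  rw [tau, map_add, map_mul, embedEta_ofFun, embedEta_psi, embedEta_psiBar]

end Doubling

end CTWSAW

end Literature.Barriers.CriticalPhenomena
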